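import Summits.AtomisticToContinuum.BoseEinsteinCondensation.Theorems.PeriodicIRBound.Negative.HardCoreScope
import Summits.AtomisticToContinuum.BoseEinsteinCondensation.Theorems.PeriodicIRBound.Negative.GroundOccupation
import Summits.AtomisticToContinuum.BoseEinsteinCondensation.Theses.BECTwoSectorGD
import Summits.AtomisticToContinuum.BoseEinsteinCondensation.Theses.BECSectorPoincareTwoScale
import Literature.MathematicalPhysics.QuantumManyBody.TorusFockLayer
import HarnessLib

/-!
# Route `BECGroundStateSOS`, crux `PeriodicIRBound` (stmt-AtomisticToContinuum-3972), line `two-sector-gd-transfer` —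
# vocabulary and registered stub statements (`Defs` module of the line)

A `Cruxes/PeriodicIRBound/Lines/*.lean` skeleton is not an importable module, so the objects the line
`two-sector-gd-transfer` posits and the STATEMENTS of its registered stubs live here, to be imported verbatim by the
stub files `Theorems/BECGroundStateSOSPeriodicIRBoundTwoSector<Stub>.lean` (landed `--supports stmt-AtomisticToContinuum-3972`)
and by the closing composition `PeriodicIRBound_of` of the skeleton `Lines/two_sector_gd_transfer.lean`
(line card `Cruxes/PeriodicIRBound/Lines/two-sector-gd-transfer.md`, idea card `Cruxes/PeriodicIRBound/Ideas/two-sector-gd-transfer.md`,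
triage r2-1/r2-2: pass ×2; picked by lead seat c11, `Cruxes/PeriodicIRBound/PICKED.md`). Contents:

* §1 the per-potential dictionary over tree declarations: `NearMinAt` (near-minimiser at general `(N, L)`,
  `nearMin_iff : Negative.NearMin … ↔ NearMinAt …` is `Iff.rfl`), `transferIntegralRe` (the one-particle transfer
  integral of stmt-AtomisticToContinuum-12620 VERBATIM), `GDFor` (the body of `BECTwoSectorGD.GaussianDomination` per
  potential, `gaussianDomination_iff : Iff.rfl`), `ConvexityFor` (the body of
  `BECSectorPoincareTwoScale.EnergyConvexityWindow` per potential, `energyConvexityWindow_iff : Iff.rfl`);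
* §2 the line's own objects — the REGULARISED channel susceptibilities `SuscPlus` / `SuscMinus` read on
  near-minimisers and the two-channel bound `TwoChannelSusceptibility` — and the statements of the line's own stubs as
  named, deliberately untagged `Prop`s (statements of a proof plan, not results in print; the audit's advisory
  `vendored-fact` class is expected until the stub files provide witnesses): `KatoSusceptibility` (S3, the
  Kato/discriminant step), `KLSMomentFor` / `KLSNearMinimiser` (S4, the Kennedy–Lieb–Shastry Cauchy–Schwarz at a
  near-minimiser), `WindowAssembly` (S5), `NonIntegrableHalf` (S6, the scope half `∫ v = ∞`, the same proposition as
  `FsumPhasePencil.NonIntegrableHalf`); the two POOLED stubs are the sibling items themselves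
  (`BECTwoSectorGD.GaussianDomination` = stmt-12620, `BECSectorPoincareTwoScale.EnergyConvexityWindow` = stmt-9094);
* §3 sorry-free lemmas: the scalar endgame `kls_quadratic` / `kls_endgame` and the dictionary
  `sqrt_mul_transferIntegralRe : √(N+1)·I(Ψ,Φ) = Re⟨Ψ, a(φ_n)Φ⟩` (`TorusFockLayer.modeAn`);
* §4 the composition of the integrable half, `integrableHalf_of : GaussianDomination → EnergyConvexityWindow →
  KatoSusceptibility → KLSNearMinimiser → WindowAssembly → ∀ v` integrable admissible, `IRBoundFor v`, registered on the
  crux ledger as the by-product stub `stub_integrableHalfOfInputs` (the third standing reduction of the crux, next to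
  `LinearPhFloorWagner.integrableClass_of_pooled` and `FsumPhasePencil`'s reduction).

References: T. Kennedy, E. H. Lieb, B. S. Shastry, J. Stat. Phys. 53 (1988) 1019, (12)–(14), (18) (the T = 0
infrared bound from Gaussian domination by a Cauchy–Schwarz / double-commutator argument); F. J. Dyson, E. H. Lieb,
B. Simon, J. Stat. Phys. 18 (1978) 335, §1; T. Kato, *Perturbation Theory for Linear Operators* (1966), II §2;
H. Wagner, Z. Physik 195 (1966) 273, §2; LSSY2005 App. A (A.13)–(A.14).
-/

noncomputable section

open scoped BigOperators ENNReal ComplexConjugate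
open Filter MeasureTheory

namespace Summit.AtomisticToContinuum.BoseEinsteinCondensation.Cruxes.PeriodicIRBound.TwoSectorGdTransfer

open Literature.MathematicalPhysics.QuantumManyBody.BoseGas
open Summit.AtomisticToContinuum.BoseEinsteinCondensation.Theses.BECGroundStateSOS (PeriodicIRBound)
open Summit.AtomisticToContinuum.BoseEinsteinCondensation.Theses.BECTwoSectorGD (GaussianDomination)
open Summit.AtomisticToContinuum.BoseEinsteinCondensation.Theses.BECSectorPoincareTwoScale (EnergyConvexityWindow)
open Summit.AtomisticToContinuum.BoseEinsteinCondensation.Theorems.PeriodicIRBound.Negative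
  (IRBoundFor NearMin InWindow IRIneq periodicIRBound_iff periodicIRBound_iff_split)

/-! ## §1 Dictionary: the pooled items per potential, the transfer matrix element, near-minimisers at fixed `(N, L)` -/

/-- **Near-minimiser at general `(N, L)`**: `⟨Ψ,HΨ⟩ ≤ E₀^per(N,L) + δ`. Along `L = L_N = (N/ρ)^{1/3}` this is the crux's
`Negative.NearMin v ρ N δ Ψ` (`nearMin_iff`, `Iff.rfl`). [folklore] -/
def NearMinAt (v : ℝ → ℝ≥0∞) {N : ℕ} {L : ℝ} (δ : ℝ≥0∞) (Ψ : PeriodicTrialState N L) : Prop :=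
  periodicEnergy v Ψ ≤ periodicGroundStateEnergy v N L + δ

/-- The crux's near-minimiser predicate is `NearMinAt` along the thermodynamic boxes. [folklore] -/
theorem nearMin_iff (v : ℝ → ℝ≥0∞) (ρ : ℝ) (N : ℕ) (δ : ℝ≥0∞) (Ψ : PeriodicTrialState N (sideLength ρ N)) :
    NearMin v ρ N δ Ψ ↔ NearMinAt v δ Ψ :=
  Iff.rfl

/-- **The one-particle transfer integral of stmt-12620, verbatim**:
`I(Ψ,Φ) = Re ∫_{Y ∈ [0,L)^{3N}} conj Ψ(Y) ∫_{x ∈ [0,L)³} conj(φ_n(x)) Φ(x, Y) dx dY`, `φ_n = L^{-3/2} cellWave L n`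
(`= planeWaveMode L n`, `Negative.mode_eq`), so that `√(N+1)·I(Ψ,Φ) = Re⟨Ψ, a(φ_n)Φ⟩ = Re⟨a†(φ_n)Ψ, Φ⟩` with the tree's
first-quantised `modeAn`/`modeCr` (`TorusFockLayer`: `modeAn_apply`, `integral_conj_modeAn_mul`). [cite: LSSY2005, App. A (A.13)] -/
def transferIntegralRe {N : ℕ} (L : ℝ) (n : Fin 3 → ℤ) (Ψ : Config N → ℂ) (Φ : Config (N + 1) → ℂ) : ℝ :=
  (∫ Y in cellN N L, conj (Ψ Y) *
      ∫ x in cell L, conj (((Real.sqrt (L ^ 3))⁻¹ : ℂ) * cellWave L n x) * Φ (Matrix.vecCons x Y)).re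

/-- **Two-sector Gaussian domination for ONE potential with data `(K, ρ₀, C)`** — the body of
`BECTwoSectorGD.GaussianDomination` (stmt-AtomisticToContinuum-12620) after its three existentials, VERBATIM
(`gaussianDomination_iff` is `Iff.rfl`): eventually in `N`, for every torus with `(N+1) ≤ ρ₀L³`, every mode `n ≠ 0` with
`2π‖n‖_∞/L ≤ K`, some `t₀(N,L,n) > 0`, all `|t| ≤ t₀`, `p ∈ [0,1]` and all finite-energy `Ψ` (`N` bodies), `Φ` (`N+1` bodies):
`p E₀(N) + (1−p) E₀(N+1) − C t² L²/‖n‖² ≤ p E(Ψ) + (1−p) E(Φ) + 2t√(p(1−p))·√(N+1)·I(Ψ,Φ)`. [cite: KLS1988JSP, (18); DLS1978, §1] -/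
def GDFor (v : ℝ → ℝ≥0∞) (K ρ₀ C : ℝ) : Prop :=
  ∀ᶠ N : ℕ in atTop, ∀ L : ℝ, 0 < L → ((N : ℝ) + 1) ≤ ρ₀ * L ^ 3 → ∀ n : Fin 3 → ℤ, n ≠ 0 →
    2 * Real.pi / L * ‖(fun j => (n j : ℝ))‖ ≤ K → ∃ t₀ : ℝ, 0 < t₀ ∧ ∀ t : ℝ, |t| ≤ t₀ →
      ∀ p : ℝ, 0 ≤ p → p ≤ 1 → ∀ Ψ : PeriodicTrialState N L, ∀ Φ : PeriodicTrialState (N + 1) L,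
        periodicEnergy v Ψ ≠ ⊤ → periodicEnergy v Φ ≠ ⊤ →
          p * (periodicGroundStateEnergy v N L).toReal +
                (1 - p) * (periodicGroundStateEnergy v (N + 1) L).toReal -
              C * t ^ 2 * L ^ 2 / ‖(fun j => (n j : ℝ))‖ ^ 2 ≤
            p * (periodicEnergy v Ψ).toReal + (1 - p) * (periodicEnergy v Φ).toReal +
              2 * t * Real.sqrt (p * (1 - p)) * Real.sqrt ((N : ℝ) + 1) * transferIntegralRe L n Ψ.ψ Φ.ψ

/-- `GaussianDomination` (stmt-12620) is `∀ v` integrable admissible `∃ K ρ₀ C > 0, GDFor v K ρ₀ C` — definitionally. [folklore] -/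
theorem gaussianDomination_iff :
    GaussianDomination ↔ ∀ v : ℝ → ℝ≥0∞, IsRepulsiveFiniteRange v → (∫⁻ x : Space, v ‖x‖) ≠ ⊤ →
      ∃ K : ℝ, 0 < K ∧ ∃ ρ₀ : ℝ, 0 < ρ₀ ∧ ∃ C : ℝ, 0 < C ∧ GDFor v K ρ₀ C :=
  Iff.rfl

/-- **Midpoint near-convexity of `N ↦ E₀^per(N, L)` for ONE potential** — the body of
`BECSectorPoincareTwoScale.EnergyConvexityWindow` (stmt-AtomisticToContinuum-9094) VERBATIM (`energyConvexityWindow_iff` is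
`Iff.rfl`): `∃ ρ₁ ∀ ε > 0 ∀ ρ < ρ₁ ∀ᶠ N ∀ L` in the density window `ρ/2 ≤ N/L³ ≤ 2ρ`:
`2E₀(N,L) ≤ E₀(N+1,L) + E₀(N−1,L) + ε√(ρa)/L`. A statement of that route's proof plan, not a result in print. -/
def ConvexityFor (v : ℝ → ℝ≥0∞) : Prop :=
  ∃ ρ₁ : ℝ, 0 < ρ₁ ∧ ∀ ε : ℝ, 0 < ε → ∀ ρ : ℝ, 0 < ρ → ρ < ρ₁ → ∀ᶠ N : ℕ in atTop, ∀ L : ℝ, 0 < L →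
    ρ / 2 ≤ (N : ℝ) / L ^ 3 → (N : ℝ) / L ^ 3 ≤ 2 * ρ →
      2 * periodicGroundStateEnergy v N L ≤
        periodicGroundStateEnergy v (N + 1) L + periodicGroundStateEnergy v (N - 1) L +
          ENNReal.ofReal (ε * Real.sqrt (ρ * (scatteringLength v).toReal) / L)

/-- `EnergyConvexityWindow` (stmt-9094) is `∀ v` admissible, `ConvexityFor v` — definitionally. [folklore] -/
theorem energyConvexityWindow_iff :
    EnergyConvexityWindow ↔ ∀ v : ℝ → ℝ≥0∞, IsRepulsiveFiniteRange v → ConvexityFor v :=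
  Iff.rfl

/-! ## §2 The line's own objects: regularised channel susceptibilities and the statements of stubs S3–S6 -/

/-- **Channel `+` (particle addition) susceptibility bound `b₊(N,n) ≤ b`, REGULARISED and read on near-minimisers**:
for every `η > 0` there is a slack `δ > 0` such that for every `δ`-near-minimiser `Ψ` of `H_N` and every finite-energy
`(N+1)`-body state `Φ`, `(Re⟨Ψ, a(φ_n)Φ⟩)² ≤ b·((1+η)(E(Φ) − E₀(N+1)) + η)`. For the exact ground state and `η → 0` this is
Kennedy–Lieb–Shastry's `b₊ = sup_Φ |⟨Φ,a†Ω⟩|²/⟨Φ,(H−E₀)Φ⟩ ≤ b`. [cite: KLS1988JSP, (12)–(14)] -/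
def SuscPlus (v : ℝ → ℝ≥0∞) (N : ℕ) (L : ℝ) (n : Fin 3 → ℤ) (b : ℝ) : Prop :=
  ∀ η : ℝ, 0 < η → ∃ δ : ℝ≥0∞, 0 < δ ∧ ∀ Ψ : PeriodicTrialState N L, NearMinAt v δ Ψ →
    ∀ Φ : PeriodicTrialState (N + 1) L, periodicEnergy v Φ ≠ ⊤ →
      (Real.sqrt ((N : ℝ) + 1) * transferIntegralRe L n Ψ.ψ Φ.ψ) ^ 2 ≤
        b * ((1 + η) * ((periodicEnergy v Φ).toReal - (periodicGroundStateEnergy v (N + 1) L).toReal) + η)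

/-- **Channel `−` (particle removal) susceptibility bound `b₋(N+1,n) ≤ b`, REGULARISED and read on near-minimisers**:
for every `η > 0` there is `δ > 0` such that for every `δ`-near-minimiser `Φ` of `H_{N+1}` and every finite-energy `N`-body
state `Ψ`, `(Re⟨Ψ, a(φ_n)Φ⟩)² ≤ b·((1+η)(E(Ψ) − E₀(N)) + η)`. [cite: KLS1988JSP, (12)–(14)] -/
def SuscMinus (v : ℝ → ℝ≥0∞) (N : ℕ) (L : ℝ) (n : Fin 3 → ℤ) (b : ℝ) : Prop :=
  ∀ η : ℝ, 0 < η → ∃ δ : ℝ≥0∞, 0 < δ ∧ ∀ Φ : PeriodicTrialState (N + 1) L, NearMinAt v δ Φ →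
    ∀ Ψ : PeriodicTrialState N L, periodicEnergy v Ψ ≠ ⊤ →
      (Real.sqrt ((N : ℝ) + 1) * transferIntegralRe L n Ψ.ψ Φ.ψ) ^ 2 ≤
        b * ((1 + η) * ((periodicEnergy v Ψ).toReal - (periodicGroundStateEnergy v N L).toReal) + η)

/-- **The two-channel susceptibility bound with data `(K, ρ₀, C)`** (conclusion of the Kato step): eventually in `N`, on
every torus with `(N+1) ≤ ρ₀L³` and finite `E₀(N), E₀(N+1)`, for every mode `0 < 2π‖n‖_∞/L ≤ K`, BOTH channels at the
sector pair `(N, N+1)` are bounded by `b = CL²/‖n‖²_∞` (`= C'/|k|²`). A statement of the proof plan (the continuum form of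
the ONE inequality reflection positivity ever supplied), not a result in print. -/
def TwoChannelSusceptibility (v : ℝ → ℝ≥0∞) (K ρ₀ C : ℝ) : Prop :=
  ∀ᶠ N : ℕ in atTop, ∀ L : ℝ, 0 < L → ((N : ℝ) + 1) ≤ ρ₀ * L ^ 3 →
    periodicGroundStateEnergy v N L ≠ ⊤ → periodicGroundStateEnergy v (N + 1) L ≠ ⊤ →
    ∀ n : Fin 3 → ℤ, n ≠ 0 → 2 * Real.pi / L * ‖(fun j => (n j : ℝ))‖ ≤ K →
      SuscPlus v N L n (C * L ^ 2 / ‖(fun j => (n j : ℝ))‖ ^ 2) ∧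
        SuscMinus v N L n (C * L ^ 2 / ‖(fun j => (n j : ℝ))‖ ^ 2)

/-- **Stub S3 statement — the Kato / discriminant step, on near-minimisers** (M/L, provable now): for an integrable
admissible `v`, `GDFor v K ρ₀ C` implies `TwoChannelSusceptibility v K ρ₀ C` (same data). Plan (channel `+`; `−` is
symmetric with `p ↔ 1−p`): with `b = CL²/‖n‖²`, `X = E(Φ) − E₀(N+1) ≥ 0`, a `δ`-near-minimiser `Ψ` (`E(Ψ) − E₀(N) ≤ δ`),
`p = 1 − q` and `t = −s·sgn(I)`, GD reads `0 ≤ (1−q)δ + qX − 2s√(q(1−q))|M| + bs²` (`M = √(N+1)·I`); the choice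
`q := min(η/(1+η), t₀²b²/(N+1), 1/2)`, `δ := ηq`, `s := √(q(1−q))|M|/b ≤ t₀` (admissible because `|M| ≤ ‖a(φ_n)Φ‖ ≤ √(N+1)`,
Cauchy–Schwarz on the cell) gives `(1−q)M² ≤ b(δ/q + X)`, i.e. `M² ≤ b((1+η)X + η)`-type bounds. Inputs: the variational
principle `E₀ ≤ E(Φ)` (`iInf_le`), `|M| ≤ √(N+1)`, real arithmetic. A statement of the proof plan (Kato 1966, II §2;
Kennedy–Lieb–Shastry 1988, (12)), not a result in print. -/
def KatoSusceptibility : Prop :=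
  ∀ v : ℝ → ℝ≥0∞, IsRepulsiveFiniteRange v → (∫⁻ x : Space, v ‖x‖) ≠ ⊤ →
    ∀ K ρ₀ C : ℝ, 0 < C → GDFor v K ρ₀ C → TwoChannelSusceptibility v K ρ₀ C

/-- **The Kennedy–Lieb–Shastry moment inequality at fixed `(N, L) = (m+2, L)` for ONE potential, read on near-minimisers**:
if both channels at `n ≠ 0` are bounded by `b ≥ 0` (`SuscPlus` at the pair `(N, N+1)`, `SuscMinus` at the pair `(N−1, N)`),
then for every `η > 0` there is `δ > 0` such that every `δ`-near-minimiser `Ψ` of `H_N` obeys, with `n_k = n_Ψ(φ_n)` and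
`y = 2n_k + 1 = ‖a(φ_n)Ψ‖² + ‖a†(φ_n)Ψ‖²`,
`y² ≤ 2b·[(1+η)·(|2πn/L|² + 2N‖v‖₁/L³ + E₀(N)·y − E₀(N−1)·n_k − E₀(N+1)·(n_k+1)) + η·(y+1)]`.
On paper: `‖a†Ψ‖⁴ ≤ b((1+η)d₊ + η‖a†Ψ‖²)`, `‖aΨ‖⁴ ≤ b((1+η)d₋ + η‖aΨ‖²)` (the channel bounds at `Φ = a†Ψ/‖a†Ψ‖`,
`Ψ' = aΨ/‖aΨ‖`, adjointness `Re⟨Ψ, a a†Ψ⟩ = ‖a†Ψ‖²`), `d₊ + d₋ = 𝓔[a†Ψ] + 𝓔[aΨ] − E₀(N+1)‖a†Ψ‖² − E₀(N−1)‖aΨ‖²`,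
`y²/2 ≤ ‖aΨ‖⁴ + ‖a†Ψ‖⁴`, and the landed Wagner–Feynman form inequality + near-minimiser polar bound
`𝓔[aΨ] + 𝓔[a†Ψ] ≤ (|2πn/L|² + 2N‖v‖₁/L³) + E₀(N) + δ + 2E₀(N)n_k + 2√(δ·𝓔[a†aΨ])` (`WF.Pkg.HeartGlue`, `WF.Pkg.Polar`,
`WF.Pkg.Kinematics`, `WF.Pkg.FormBounds2`; CCR `modeAn_modeCr_apply`, adjointness `integral_conj_modeAn_mul`); `δ` small
absorbs the last two terms into `η(y+1)`. A statement of the proof plan, not a result in print.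
[cite: KLS1988JSP, (12)–(14); Wagner1966, §2] -/
def KLSMomentFor (v : ℝ → ℝ≥0∞) : Prop :=
  ∀ (m : ℕ) (L : ℝ), 0 < L →
    periodicGroundStateEnergy v (m + 1) L ≠ ⊤ → periodicGroundStateEnergy v (m + 2) L ≠ ⊤ →
    periodicGroundStateEnergy v (m + 3) L ≠ ⊤ →
    ∀ n : Fin 3 → ℤ, n ≠ 0 → ∀ b : ℝ, 0 ≤ b → SuscPlus v (m + 2) L n b → SuscMinus v (m + 1) L n b →
      ∀ η : ℝ, 0 < η → ∃ δ : ℝ≥0∞, 0 < δ ∧ ∀ Ψ : PeriodicTrialState (m + 2) L, NearMinAt v δ Ψ →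
        let nk : ℝ := (cellOccupation (m + 2) L (planeWaveMode L n) Ψ.ψ).toReal
        (2 * nk + 1) ^ 2 ≤
          2 * b * ((1 + η) * (‖latticeVec (2 * Real.pi / L) n‖ ^ 2 +
              2 * ((m : ℝ) + 2) * (∫⁻ x : Space, v ‖x‖).toReal / L ^ 3 +
              (periodicGroundStateEnergy v (m + 2) L).toReal * (2 * nk + 1) -
              (periodicGroundStateEnergy v (m + 1) L).toReal * nk -
              (periodicGroundStateEnergy v (m + 3) L).toReal * (nk + 1)) +
            η * (2 * nk + 2))

/-- **Stub S4 statement — the KLS Cauchy–Schwarz at a near-minimiser** (L/XL in Lean, no open mathematics; the hardest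
OWN stub): `KLSMomentFor v` for every integrable admissible `v`. -/
def KLSNearMinimiser : Prop :=
  ∀ v : ℝ → ℝ≥0∞, IsRepulsiveFiniteRange v → (∫⁻ x : Space, v ‖x‖) ≠ ⊤ → KLSMomentFor v

/-- **Stub S5 statement — window arithmetic, convexity bookkeeping and the scalar endgame** (M/L, provable now): for an
integrable admissible `v`, the two-channel bound with data `(K, ρ₀, C)`, the fixed-`(N,L)` moment inequality and midpoint
near-convexity give the crux for `v`. Plan: fix `κ > 0`; `ρ₀' := min(ρ₀/2, ρ₁, K²/(4π²κ²))` (window `‖n‖_∞ ≤ κ√ρL_N` ⇒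
`2π‖n‖_∞/L_N ≤ 2πκ√ρ ≤ K`; `(N+1) ≤ ρ₀L_N³` and `N ≤ ρ₀L_N³` from `L_N³ = N/ρ`, `ρ < ρ₀/2`); eventually in `N` (the
two-channel bound at `N` and at `N−1`, convexity at `L = L_N` with `N/L_N³ = ρ` in `[ρ/2, 2ρ]` and `ε := 1`, finiteness
`E₀(N±1,L_N), E₀(N,L_N) < ⊤` for integrable `v`); at fixed `N`: `η_n := min(1, ‖n‖²/(CL_N²))`, `δ_N :=` least `δ(n, η_n)` over the
finite window (`Negative.inWindow_mem_box`); monotonicity `E₀(N−1) ≤ E₀(N+1)` and convexity turn S4's bracket into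
`D + (ε√(ρa)/L_N)·y/2`, `D ≤ 12π²‖n‖²/L_N² + 2ρ‖v‖₁`; `kls_quadratic` gives
`y ≤ 2be + 4bη + 2√(b(D+η)) ≤ 2Cε√a·√ρL_N/‖n‖ + 6 + 2√(12π²C) + 2√(2C‖v‖₁)·√ρL_N/‖n‖`, and `1 ≤ κ√ρL_N/‖n‖` on the window
absorbs the constants: `n_k ≤ [Cε√a + √(2C‖v‖₁) + κ(3 + 2π√(3C))]·√ρL_N/‖n‖_∞`. A statement of the proof plan, not a
result in print. -/
def WindowAssembly : Prop :=
  ∀ v : ℝ → ℝ≥0∞, IsRepulsiveFiniteRange v → (∫⁻ x : Space, v ‖x‖) ≠ ⊤ →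
    ∀ K ρ₀ C : ℝ, 0 < K → 0 < ρ₀ → 0 < C →
      TwoChannelSusceptibility v K ρ₀ C → KLSMomentFor v → ConvexityFor v → IRBoundFor v

/-- **Stub S6 statement — the NON-INTEGRABLE half** (`∫ v(|x|)dx = ∞`: hard cores, non-`L¹` spikes; `Negative` §19
`hardCore_in_scope`): the crux verbatim on that class — the second conjunct of `Negative.periodicIRBound_iff_split`, the
same proposition as the sibling line's registered `FsumPhasePencil.stub_nonIntegrableHalf`. NOT reduced by this line (the
undressed `a†(φ_n)` adds a plane-wave particle of infinite Hartree energy; a Jastrow/Dyson-dressed transfer operator, the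
a-native class-uniform truncation module of card `hardcore-monotone-class-uniformity`, or route BECHardSphereReduction
are the expected discharges; shared debt with stmt-12621 / stmt-11844). It IS the crux on a sub-class. -/
def NonIntegrableHalf : Prop :=
  ∀ v : ℝ → ℝ≥0∞, IsRepulsiveFiniteRange v → (∫⁻ x : Space, v ‖x‖) = ⊤ → IRBoundFor v

/-! ## §3 Sorry-free lemmas: the scalar endgame and the transfer-operator dictionary -/

/-- **KLS scalar endgame** (PROVED; ideator 4's `IdeatorSketchR2K4.kls_quadratic`, hypothesis `0 ≤ y` dropped): if `y`
satisfies `y² ≤ b(d + e·y)` with `b, d, e ≥ 0` then `y ≤ b·e + √(b·d)` — the `1/‖k‖` law `√(bd)` plus the convexity term `b·e`.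
[folklore] -/
theorem kls_quadratic {y b d e : ℝ} (hb : 0 ≤ b) (hd : 0 ≤ d) (he : 0 ≤ e)
    (h : y ^ 2 ≤ b * (d + e * y)) : y ≤ b * e + Real.sqrt (b * d) := by
  have hbd : 0 ≤ b * d := mul_nonneg hb hd
  have hs : Real.sqrt (b * d) ^ 2 = b * d := Real.sq_sqrt hbd
  have hs0 : 0 ≤ Real.sqrt (b * d) := Real.sqrt_nonneg _
  by_contra hlt
  push Not at hlt
  have hbe : 0 ≤ b * e := mul_nonneg hb he
  have hypos : 0 < y := lt_of_le_of_lt (add_nonneg hbe hs0) hlt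
  have h1 : (b * e + Real.sqrt (b * d)) * y < y * y := mul_lt_mul_of_pos_right hlt hypos
  have h2 : b * e * y + b * d ≤ (b * e + Real.sqrt (b * d)) * y := by
    have : Real.sqrt (b * d) * Real.sqrt (b * d) ≤ Real.sqrt (b * d) * y :=
      mul_le_mul_of_nonneg_left (le_of_lt (lt_of_le_of_lt (by linarith [hbe]) hlt)) hs0
    nlinarith [this, hs]
  have h3 : b * (d + e * y) < y ^ 2 := by nlinarith [h1, h2]
  exact absurd h (not_le.2 h3)

/-- **The scalar endgame in the form S5 uses it**: from S4's shape (after convexity, `ep = (2E₀(N) − E₀(N−1) − E₀(N+1))₊`)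
`y² ≤ 2b[(1+η)(D + ep·y/2) + η(y+1)]`, bound `y ≤ 2b(1+η)(ep/2 + η) + √(2b(1+η)(D+η))`. [folklore] -/
theorem kls_endgame {y b η D ep : ℝ} (hy : 0 ≤ y) (hb : 0 ≤ b) (hη : 0 ≤ η) (hD : 0 ≤ D) (he : 0 ≤ ep)
    (h : y ^ 2 ≤ 2 * b * ((1 + η) * (D + ep * (y / 2)) + η * (y + 1))) :
    y ≤ 2 * b * (1 + η) * (ep / 2 + η) + Real.sqrt (2 * b * (1 + η) * (D + η)) := by
  have hB : 0 ≤ 2 * b * (1 + η) := by positivity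
  have hd : (0 : ℝ) ≤ D + η := by positivity
  have he' : (0 : ℝ) ≤ ep / 2 + η := by positivity
  refine kls_quadratic hB hd he' (le_trans h ?_)
  have h0 : 0 ≤ 2 * b * η ^ 2 * (1 + y) := by positivity
  nlinarith [h0]

/-- **Dictionary**: `√(N+1)·I(Ψ,Φ) = Re⟨Ψ, a(φ_n)Φ⟩` with the tree's first-quantised annihilation operator `modeAn` and
`φ_n = planeWaveMode L n`. [cite: LSSY2005, App. A (A.13)] -/
theorem sqrt_mul_transferIntegralRe {N : ℕ} (L : ℝ) (n : Fin 3 → ℤ) (Ψ : Config N → ℂ) (Φ : Config (N + 1) → ℂ) :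
    Real.sqrt ((N : ℝ) + 1) * transferIntegralRe L n Ψ Φ =
      (∫ Y in cellN N L, conj (Ψ Y) * modeAn L (planeWaveMode L n) Φ Y).re := by
  unfold transferIntegralRe
  have key : (fun Y => conj (Ψ Y) * modeAn L (planeWaveMode L n) Φ Y) =
      fun Y => ((Real.sqrt ((N : ℝ) + 1) : ℝ) : ℂ) *
        (conj (Ψ Y) * ∫ x in cell L, conj (((Real.sqrt (L ^ 3))⁻¹ : ℂ) * cellWave L n x) * Φ (Matrix.vecCons x Y)) := by
    funext Y
    simp only [modeAn_apply, planeWaveMode_eq]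
    ring
  rw [key, integral_const_mul, Complex.re_ofReal_mul]

/-! ## §4 Composition of the integrable half (sorry-free) -/

/-- **The integrable half of the crux from S1–S5.** For an integrable admissible `v`: GD supplies `(K, ρ₀, C)` with
`GDFor v K ρ₀ C` (`gaussianDomination_iff`), the Kato step turns it into the two-channel susceptibility bound, and the
window assembly combines it with the fixed-`(N,L)` KLS inequality and midpoint convexity (`energyConvexityWindow_iff`).
[folklore] -/
theorem integrableHalf_of (h1 : GaussianDomination) (h2 : EnergyConvexityWindow) (h3 : KatoSusceptibility)
    (h4 : KLSNearMinimiser) (h5 : WindowAssembly) :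
    ∀ v : ℝ → ℝ≥0∞, IsRepulsiveFiniteRange v → (∫⁻ x : Space, v ‖x‖) ≠ ⊤ → IRBoundFor v := by
  intro v hv hint
  obtain ⟨K, hK, ρ₀, hρ₀, C, hC, hGD⟩ := gaussianDomination_iff.1 h1 v hv hint
  exact h5 v hv hint K ρ₀ C hK hρ₀ hC (h3 v hv hint K ρ₀ C hC hGD) (h4 v hv hint)
    (energyConvexityWindow_iff.1 h2 v hv)

/-- **Registered by-product stub `stub_integrableHalfOfInputs` of the crux ledger** (line `two-sector-gd-transfer`):
the pooled items stmt-12620 (`GaussianDomination`) and stmt-9094 (`EnergyConvexityWindow`) together with the line's own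
stubs S3–S5 give the crux's infrared inequality `IRBoundFor v` for every INTEGRABLE admissible `v` — the third
standing reduction of `PeriodicIRBound` (this module's `integrableHalf_of`). [folklore] -/
theorem stub_integrableHalfOfInputs :
    GaussianDomination → EnergyConvexityWindow → KatoSusceptibility → KLSNearMinimiser → WindowAssembly →
      ∀ v : ℝ → ℝ≥0∞, IsRepulsiveFiniteRange v → (∫⁻ x : Space, v ‖x‖) ≠ ⊤ → IRBoundFor v :=
  integrableHalf_of

end Summit.AtomisticToContinuum.BoseEinsteinCondensation.Cruxes.PeriodicIRBound.TwoSectorGdTransfer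

end
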